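import Literature.MathematicalPhysics.QuantumFieldTheory.Balaban1983to89.T3MinimiserStabilityReduction
import HarnessLib

/-!
# `Balaban1983to89.T3ThresholdSmallness` — rung R3: Bałaban's small-field thresholds `θ(i) = g_i·p(g_i)` TEND TO ZERO, uniformly in the
# height `i` as the terminal coupling `γ → 0`, and in `i → ∞` at fixed `γ`

Cell `ym3-torus` (HUMAN RULING D-0037, YM ladder rung R3), seat `ym3-torus-p1` gen 5.  WHAT THIS IS NOT: no estimate of the series — elementary
real analysis about the PROFILE `p(g) = b₀(1 + log g⁻¹)^{p₀}` of [Balaban1985UV3] (7) p. 257 (tree `B10.pFun`) and the thresholds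
`θBal L γ b₀ p₀ i = g_i·p(g_i)`, `g_i = √(γL^{−i})` (tree `T3UnitScaleTilt.θBal`), used by EVERY line of the route `UnitScaleTilt` at the
step «for `γ ≤ γ₁(ε₀, …)` the datum's threshold `B₃·θBal(⌊K/m⌋)` is below the regularity radius `ε₀`» ([Balaban1985Variational] Thm 1 needs
`B₃ε₁ ≤ ε₀ ≤ a₀`; [Balaban1985UV3] p. 259 (13), p. 268 use `g_kp(g_k)` small).

* `tendsto_mul_pFun_nhdsGT_zero` — `g·p(g) → 0` as `g → 0⁺`, for every `b₀` and every real exponent `p₀` (via Mathlib's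
  `tendsto_log_mul_rpow_nhdsGT_zero`: `log g · g^r → 0`);
* `sqrt_coupling_pos_le` — `0 < g_i = √(γL^{−i}) ≤ √γ` (`L ≥ 1`), so any bound on `(0, √γ]` transfers to every height;
* `exists_forall_θBal_le` — **for every `ε > 0` there is `γ₁ > 0` with `θBal L γ b₀ p₀ i ≤ ε` for ALL `0 < γ ≤ γ₁` and ALL heights `i`**;
* `tendsto_θBal_atTop` — at fixed `γ > 0` and `L > 1`, `θBal L γ b₀ p₀ i → 0` as `i → ∞`.

References: T. Bałaban, CMP 102 (1985) 255–275 [Balaban1985UV3] ((7) p.257, (3) p.256); CMP 102 (1985) 277–309 [Balaban1985Variational] (Thm 1 p.279).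
-/

noncomputable section

open Filter Topology
open Literature.MathematicalPhysics.QuantumFieldTheory.Balaban1983to89.T3UnitScaleTilt

namespace Literature.MathematicalPhysics.QuantumFieldTheory.Balaban1983to89.T3ThresholdSmallness

/-! ## §1 `g·p(g) → 0` as `g → 0⁺` -/

/-- For `0 < g ≤ e⁻¹` and `q ≥ max p₀ 0`: `(1 + log g⁻¹)^{p₀} ≤ (2·(−log g))^{q}` (base `≥ 1`: raise the exponent, then `1 + (−log g) ≤ 2(−log g)`
as `−log g ≥ 1`). [cite: Balaban1985UV3, (7) p.257] -/
theorem one_add_log_inv_rpow_le {g p₀ q : ℝ} (hg : 0 < g) (hge : g ≤ Real.exp (-1)) (hq : max p₀ 0 ≤ q) :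
    (1 + Real.log g⁻¹) ^ p₀ ≤ (2 * (-Real.log g)) ^ q := by
  have hlog : 1 ≤ -Real.log g := by
    have h := Real.log_le_log hg hge
    rw [Real.log_exp] at h
    linarith
  have hbase : (1 : ℝ) ≤ 1 + Real.log g⁻¹ := by rw [Real.log_inv]; linarith
  calc (1 + Real.log g⁻¹) ^ p₀ ≤ (1 + Real.log g⁻¹) ^ q :=
        Real.rpow_le_rpow_of_exponent_le hbase ((le_max_left _ _).trans hq)
    _ ≤ (2 * (-Real.log g)) ^ q := by
        refine Real.rpow_le_rpow (by linarith) ?_ ((le_max_right _ _).trans hq)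
        rw [Real.log_inv]; linarith

/-- `g·(−log g)^q → 0` as `g → 0⁺` for `q > 0`: `g(−log g)^q = ((−log g)·g^{1/q})^q` and `log g · g^{1/q} → 0`
(Mathlib `tendsto_log_mul_rpow_nhdsGT_zero`). [cite: Balaban1985UV3, (7) p.257] -/
theorem tendsto_mul_neg_log_rpow_nhdsGT_zero {q : ℝ} (hq : 0 < q) :
    Tendsto (fun g : ℝ => g * (-Real.log g) ^ q) (𝓝[>] 0) (𝓝 0) := by
  have h1 : Tendsto (fun g : ℝ => -(Real.log g * g ^ (1 / q))) (𝓝[>] 0) (𝓝 0) := by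
    simpa using (tendsto_log_mul_rpow_nhdsGT_zero (one_div_pos.mpr hq)).neg
  have h2 : Tendsto (fun g : ℝ => (-(Real.log g * g ^ (1 / q))) ^ q) (𝓝[>] 0) (𝓝 0) := by
    have hc := ((Real.continuous_rpow_const hq.le).tendsto 0).comp h1
    rw [Real.zero_rpow hq.ne'] at hc
    exact hc
  refine h2.congr' ?_
  filter_upwards [Ioo_mem_nhdsGT (zero_lt_one' ℝ)] with g hg
  have hg0 : 0 ≤ g := le_of_lt hg.1
  have hgq : 0 ≤ g ^ (1 / q) := Real.rpow_nonneg hg0 _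
  have hl : 0 ≤ -Real.log g := neg_nonneg.mpr (Real.log_nonpos hg0 hg.2.le)
  show (-(Real.log g * g ^ (1 / q))) ^ q = g * (-Real.log g) ^ q
  rw [show -(Real.log g * g ^ (1 / q)) = (-Real.log g) * g ^ (1 / q) by ring,
    Real.mul_rpow hl hgq, ← Real.rpow_mul hg0, one_div_mul_cancel hq.ne', Real.rpow_one, mul_comm]

/-- **`g·p(g) → 0` as `g → 0⁺`**, `p(g) = b₀(1 + log g⁻¹)^{p₀}`, for every `b₀` and every real `p₀` (squeeze between `0` and
`|b₀|·2^q·g(−log g)^q`, `q = max p₀ 0 + 1`, on `(0, e⁻¹]`). [cite: Balaban1985UV3, (7) p.257] -/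
theorem tendsto_mul_pFun_nhdsGT_zero (b₀ p₀ : ℝ) :
    Tendsto (fun g : ℝ => g * B10.pFun b₀ p₀ g) (𝓝[>] 0) (𝓝 0) := by
  set q : ℝ := max p₀ 0 + 1 with hq
  have hq0 : 0 < q := by have := le_max_right p₀ 0; linarith
  have hmaj : Tendsto (fun g : ℝ => |b₀| * (2 : ℝ) ^ q * (g * (-Real.log g) ^ q)) (𝓝[>] 0) (𝓝 0) := by
    simpa using (tendsto_mul_neg_log_rpow_nhdsGT_zero hq0).const_mul (|b₀| * (2 : ℝ) ^ q)
  refine squeeze_zero_norm' ?_ hmaj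
  filter_upwards [Ioc_mem_nhdsGT (Real.exp_pos (-1))] with g hg
  have hg0 : 0 < g := hg.1
  have hl : 0 ≤ -Real.log g := by
    have : g ≤ 1 := hg.2.trans (by have := Real.exp_le_one_iff.mpr (by norm_num : (-1 : ℝ) ≤ 0); exact this)
    exact neg_nonneg.mpr (Real.log_nonpos hg0.le this)
  have hbase : 0 ≤ 1 + Real.log g⁻¹ := by rw [Real.log_inv]; linarith
  have hpow : (1 + Real.log g⁻¹) ^ p₀ ≤ (2 * (-Real.log g)) ^ q :=
    one_add_log_inv_rpow_le hg0 hg.2 (by linarith)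
  have hpow0 : 0 ≤ (1 + Real.log g⁻¹) ^ p₀ := Real.rpow_nonneg hbase _
  show ‖g * B10.pFun b₀ p₀ g‖ ≤ |b₀| * (2 : ℝ) ^ q * (g * (-Real.log g) ^ q)
  unfold B10.pFun
  rw [Real.norm_eq_abs, abs_mul, abs_of_pos hg0, abs_mul, abs_of_nonneg hpow0]
  rw [Real.mul_rpow (by norm_num) hl] at hpow
  have h2q : 0 ≤ (2 : ℝ) ^ q := Real.rpow_nonneg (by norm_num) _
  have hlq : 0 ≤ (-Real.log g) ^ q := Real.rpow_nonneg hl _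
  calc g * (|b₀| * (1 + Real.log g⁻¹) ^ p₀) = |b₀| * (g * (1 + Real.log g⁻¹) ^ p₀) := by ring
    _ ≤ |b₀| * (g * ((2 : ℝ) ^ q * (-Real.log g) ^ q)) :=
        mul_le_mul_of_nonneg_left (mul_le_mul_of_nonneg_left hpow hg0.le) (abs_nonneg _)
    _ = |b₀| * (2 : ℝ) ^ q * (g * (-Real.log g) ^ q) := by ring

/-! ## §2 The thresholds `θBal L γ b₀ p₀ i = g_i·p(g_i)`, `g_i = √(γL^{−i})` -/

/-- The effective coupling at height `i`: `0 < g_i = √(γL^{−i}) ≤ √γ` for `γ > 0`, `L ≥ 1`. [cite: Balaban1985UV3, (3) p.256] -/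
theorem sqrt_coupling_pos_le {L : ℕ} (hL : 1 ≤ L) {γ : ℝ} (hγ : 0 < γ) (i : ℕ) :
    0 < Real.sqrt (γ * ((L : ℝ)⁻¹) ^ i) ∧ Real.sqrt (γ * ((L : ℝ)⁻¹) ^ i) ≤ Real.sqrt γ := by
  have hL' : (1 : ℝ) ≤ L := by exact_mod_cast hL
  have hLi : 0 < ((L : ℝ)⁻¹) ^ i := pow_pos (inv_pos.mpr (by linarith)) i
  have hLi1 : ((L : ℝ)⁻¹) ^ i ≤ 1 := pow_le_one₀ (inv_nonneg.mpr (by linarith)) (inv_le_one_of_one_le₀ hL')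
  exact ⟨Real.sqrt_pos.mpr (mul_pos hγ hLi), Real.sqrt_le_sqrt (by nlinarith)⟩

/-- **UNIFORM SMALLNESS OF THE THRESHOLDS**: for every `ε > 0` there is `γ₁ > 0` such that `θBal L γ b₀ p₀ i ≤ ε` for ALL `0 < γ ≤ γ₁` and
ALL heights `i` (`L ≥ 1`; every `g_i` lies in `(0, √γ] ⊆ (0, √γ₁]`, where `g·p(g)` is already below `ε`). This is the «for `γ ≤ γ₁(ε₀)`,
`B₃·θBal ≤ ε₀` at every height» step of the route's lines. [cite: Balaban1985Variational, Thm 1 p.279] -/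
theorem exists_forall_θBal_le {L : ℕ} (hL : 1 ≤ L) (b₀ p₀ : ℝ) {ε : ℝ} (hε : 0 < ε) :
    ∃ γ₁ : ℝ, 0 < γ₁ ∧ ∀ γ : ℝ, 0 < γ → γ ≤ γ₁ → ∀ i : ℕ, θBal L γ b₀ p₀ i ≤ ε := by
  -- `g·p(g) < ε` on some `(0, δ)`
  have hev : ∀ᶠ g in 𝓝[>] (0 : ℝ), g * B10.pFun b₀ p₀ g < ε :=
    (tendsto_mul_pFun_nhdsGT_zero b₀ p₀).eventually (gt_mem_nhds hε)
  obtain ⟨δ, hδ, hball⟩ := (nhdsGT_basis (0 : ℝ)).eventually_iff.mp hev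
  -- `γ₁ := (δ/2)²`: then `√γ ≤ δ/2 < δ`
  refine ⟨(δ / 2) ^ 2, by positivity, fun γ hγ hγ₁ i => ?_⟩
  obtain ⟨hgpos, hgle⟩ := sqrt_coupling_pos_le hL hγ i
  have hsqrt : Real.sqrt γ ≤ δ / 2 := by
    rw [show δ / 2 = Real.sqrt ((δ / 2) ^ 2) by rw [Real.sqrt_sq (by positivity)]]
    exact Real.sqrt_le_sqrt hγ₁
  have hmem : Real.sqrt (γ * ((L : ℝ)⁻¹) ^ i) ∈ Set.Ioo (0 : ℝ) δ := ⟨hgpos, by linarith⟩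
  exact (hball hmem).le

/-- **THE THRESHOLDS VANISH IN THE ULTRAVIOLET** at fixed `γ > 0`, `L > 1`: `θBal L γ b₀ p₀ i → 0` as `i → ∞` (`g_i → 0⁺`).
[cite: Balaban1985UV3, (3) p.256 and (7) p.257] -/
theorem tendsto_θBal_atTop {L : ℕ} (hL : 1 < L) {γ : ℝ} (hγ : 0 < γ) (b₀ p₀ : ℝ) :
    Tendsto (fun i : ℕ => θBal L γ b₀ p₀ i) atTop (𝓝 0) := by
  have hL' : (1 : ℝ) < L := by exact_mod_cast hL
  -- `g_i → 0`, and `g_i > 0`, so `g_i → 0` within `(0, ∞)`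
  have hpow : Tendsto (fun i : ℕ => γ * ((L : ℝ)⁻¹) ^ i) atTop (𝓝 0) := by
    have h := (tendsto_pow_atTop_nhds_zero_of_lt_one (inv_nonneg.mpr (by linarith))
      (inv_lt_one_of_one_lt₀ hL')).const_mul γ
    rw [mul_zero] at h
    exact h
  have hsqrt : Tendsto (fun i : ℕ => Real.sqrt (γ * ((L : ℝ)⁻¹) ^ i)) atTop (𝓝 0) := by
    have h := (Real.continuous_sqrt.tendsto 0).comp hpow
    rw [Real.sqrt_zero] at h
    exact h
  have hwithin : Tendsto (fun i : ℕ => Real.sqrt (γ * ((L : ℝ)⁻¹) ^ i)) atTop (𝓝[>] 0) :=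
    tendsto_nhdsWithin_iff.mpr ⟨hsqrt, Eventually.of_forall fun i => (sqrt_coupling_pos_le hL.le hγ i).1⟩
  exact (tendsto_mul_pFun_nhdsGT_zero b₀ p₀).comp hwithin

end Literature.MathematicalPhysics.QuantumFieldTheory.Balaban1983to89.T3ThresholdSmallness

end
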